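import Summits.HodgeConjecture.HodgeConjecture.Theses.So7OddThetaNulls
import HarnessLib

/-!
# Assembly of route `So7OddThetaNulls` (stmt-HodgeConjecture-18792)

The assembly item of route `So7OddThetaNulls` is, verbatim, the curried form of the route file's deciding
theorem `closes` (sorry-free in `Theses/So7OddThetaNulls.lean`); this file records it as a theorem so the
item closes. No mathematics beyond the route file's own `closes`.
-/

set_option linter.dupNamespace false

namespace Summit.HodgeConjecture.HodgeConjecture.Theorems

/-- **Assembly of route `So7OddThetaNulls`** (item stmt-HodgeConjecture-18792): the route's cruxes and
supports imply the summit statement exactly as composed by the route file's deciding theorem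
`Summit.HodgeConjecture.HodgeConjecture.Theses.So7OddThetaNulls.closes`, of which this is the curried
restatement. -/
theorem so7OddThetaNulls_assembly_proof :
    Summit.HodgeConjecture.HodgeConjecture.Theses.So7OddThetaNulls.Assembly :=
  fun h₁ h₂ h₃ h₄ ↦ Summit.HodgeConjecture.HodgeConjecture.Theses.So7OddThetaNulls.closes h₁ h₂ h₃ h₄

end Summit.HodgeConjecture.HodgeConjecture.Theorems
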